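import Mathlib
import Literature.Computability.AlgebraicComplexity.HessianAtOrigin
import Summits.ValiantsHypothesis.ValiantsHypothesis.Theorems.GrenetZeonTwoDimCoefficientsScalingRayInterpolation

/-!
# Crux `GrenetZeon.TwoDimCoefficients` (stmt-ValiantsHypothesis-8062), stub `stub_dualUnipotent`:
# scaling-closure — NODE SELECTION for ray interpolation (factor programme, brick L3b)

✓ `rank_sum_smul_hess0_le_of_rayNodes` (`…ScalingRayInterpolation.lean`) needs a set of ray parameters `t_i`
whose generalized Vandermonde matrix `(t_i^{k_e})_{i,e}` is left-invertible.  This file supplies it from the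
natural data of the factor programme: the zeros of a factor `G` on a generic ray are `deg G` DISTINCT
parameters, and the exponents `k_e = deg Ψ_e − 2` of its forms of degree `≥ 2` are distinct and `< deg G`:

* `linearIndependent_col_pow` — for `g` distinct nodes and distinct exponents `< g`, the columns
  `(t_i^{k_e})_i` are linearly independent (a nonzero polynomial of degree `< g` has fewer than `g` roots);
* `exists_submatrix_isUnit_of_linearIndependent_col` — a matrix with independent columns has an invertible
  maximal square submatrix (row selection);
* ★ `exists_rayNodes_leftInverse` — hence some `#E` of the nodes carry an invertible generalized Vandermonde;
* ★ `rank_sum_smul_hess0_le_of_rayZeros` — RAY INTERPOLATION, final form: if `G = c + Σ_{e∈E} Ψ_e` (forms of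
  distinct degrees `d_e ≥ 2`), and on the ray `t ↦ t·z` there are `g > max_e (d_e − 2)` distinct parameters at
  which `rank Hess G ≤ ρ`, then every combination `Σ_e a_e·Hess Ψ_e(z)` has rank `≤ #E·ρ`.

HONEST FRAMING: generic linear algebra; the stub `DualUnipotentBound`, the crux and `VP ≠ VNP` remain open.

References: folklore (Vandermonde / Lagrange interpolation).
-/

-- single-conjunct layout `Summits/ValiantsHypothesis/ValiantsHypothesis`: the duplicated namespace
-- component is mandated by the tree.
set_option linter.dupNamespace false
set_option autoImplicit false

noncomputable section

namespace Summit.ValiantsHypothesis.ValiantsHypothesis.Theorems.GrenetZeonTwoDimCoefficients.ScalingClosure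

open MvPolynomial Matrix
open Literature.Computability.AlgebraicComplexity

/-! ### Generalized Vandermonde columns and row selection -/

section Vandermonde

variable {K : Type*} [Field K]

/-- **Distinct nodes, distinct exponents below the number of nodes ⟹ independent power columns.**
[folklore] -/
theorem linearIndependent_col_pow {g : ℕ} (t : Fin g → K) (ht : Function.Injective t) {E : Type*}
    [Fintype E] (k : E → ℕ) (hk : Function.Injective k) (hkg : ∀ e, k e < g) :
    LinearIndependent K (Matrix.of fun (i : Fin g) (e : E) => t i ^ k e).col := by
  classical
  rw [Fintype.linearIndependent_iff]
  intro c hc e₀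
  set P : Polynomial K := ∑ e, Polynomial.C (c e) * Polynomial.X ^ k e with hP
  have heval : ∀ i, P.eval (t i) = 0 := by
    intro i
    have h := congrFun hc i
    simp only [Finset.sum_apply, Pi.smul_apply, Matrix.col_apply, Matrix.of_apply, smul_eq_mul,
      Pi.zero_apply] at h
    rw [hP, Polynomial.eval_finsetSum]
    simpa only [Polynomial.eval_mul, Polynomial.eval_C, Polynomial.eval_pow, Polynomial.eval_X] using h
  have hdeg : P.natDegree < Fintype.card (Fin g) := by
    rw [Fintype.card_fin]
    rcases Nat.eq_zero_or_pos g with hg | hg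
    · exact absurd (hkg e₀) (by omega)
    refine lt_of_le_of_lt (Polynomial.natDegree_sum_le_of_forall_le _ _ (n := g - 1) fun e _ => ?_) (by omega)
    exact (Polynomial.natDegree_C_mul_X_pow_le (c e) (k e)).trans (by have := hkg e; omega)
  have hP0 : P = 0 := Polynomial.eq_zero_of_natDegree_lt_card_of_eval_eq_zero P ht heval hdeg
  have hcoeff : P.coeff (k e₀) = c e₀ := by
    rw [hP, Polynomial.finsetSum_coeff, Finset.sum_eq_single e₀]
    · rw [Polynomial.coeff_C_mul_X_pow, if_pos rfl]
    · intro e _ he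
      rw [Polynomial.coeff_C_mul_X_pow, if_neg (fun h => he (hk h).symm)]
    · intro h; exact (h (Finset.mem_univ _)).elim
  rw [← hcoeff, hP0, Polynomial.coeff_zero]

/-- **Row selection**: a matrix over a field with linearly independent columns has an invertible square
submatrix of full size obtained by selecting rows. [folklore] -/
theorem exists_submatrix_isUnit_of_linearIndependent_col {ι E : Type*} [Fintype ι] [Fintype E]
    [DecidableEq E] (V : Matrix ι E K) (hV : LinearIndependent K V.col) :
    ∃ f : E → ι, Function.Injective f ∧ IsUnit (V.submatrix f id) := by
  classical
  have hrank : V.rank = Fintype.card E := by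
    rw [← rank_transpose]
    exact hV.rank_matrix
  have hspan : Submodule.span K (Set.range V.row) = ⊤ := by
    apply Submodule.eq_top_of_finrank_eq
    rw [← rank_eq_finrank_span_row, hrank, Module.finrank_fintype_fun_eq_card]
  obtain ⟨κ, a, ha, hsp, hli⟩ := exists_linearIndependent' K V.row
  letI : Fintype κ := Fintype.ofInjective a ha
  have hcard : Fintype.card κ = Fintype.card E := by
    have h := finrank_span_eq_card hli
    rw [hsp, hspan, finrank_top, Module.finrank_fintype_fun_eq_card] at h
    exact h.symm
  obtain ⟨eqv⟩ : Nonempty (E ≃ κ) := Fintype.card_eq.mp hcard.symm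
  refine ⟨a ∘ eqv, ha.comp eqv.injective, ?_⟩
  rw [← Matrix.linearIndependent_rows_iff_isUnit]
  exact hli.comp eqv eqv.injective

/-- ★ **Node selection.**  From `g` distinct nodes and distinct exponents `< g`, some `#E` nodes carry an
invertible generalized Vandermonde matrix (with an explicit left inverse). [folklore] -/
theorem exists_rayNodes_leftInverse {g : ℕ} (t : Fin g → K) (ht : Function.Injective t) {E : Type*}
    [Fintype E] [DecidableEq E] (k : E → ℕ) (hk : Function.Injective k) (hkg : ∀ e, k e < g) :
    ∃ f : E → Fin g, Function.Injective f ∧ ∃ W : Matrix E E K,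
      W * (Matrix.of fun (i : E) (e : E) => t (f i) ^ k e) = 1 := by
  obtain ⟨f, hf, hU⟩ := exists_submatrix_isUnit_of_linearIndependent_col _
    (linearIndependent_col_pow t ht k hk hkg)
  refine ⟨f, hf, ((Matrix.of fun (i : Fin g) (e : E) => t i ^ k e).submatrix f id)⁻¹, ?_⟩
  have h := Matrix.nonsing_inv_mul _ ((Matrix.isUnit_iff_isUnit_det _).mp hU)
  exact h

end Vandermonde

/-! ### Ray interpolation from the zeros of a factor on a ray -/

section Ray

variable {σ : Type*} [Fintype σ] [DecidableEq σ]

/-- ★ **Ray interpolation of Hessian rank bounds, final form.**  Let `G = c + Σ_{e ∈ E} Ψ_e` with `Ψ_e` forms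
of pairwise distinct degrees `d_e ≥ 2`, `z` a point, and `t_1, …, t_g` DISTINCT ray parameters with
`g > d_e − 2` for all `e` (e.g. the `deg G` simple zeros of `t ↦ G(t·z)` for generic `z`) at which
`rank Hess G(t_i·z) ≤ ρ`.  Then every combination `Σ_e a_e·Hess Ψ_e(z)` has rank `≤ #E·ρ`. [folklore] -/
theorem rank_sum_smul_hess0_le_of_rayZeros {E : Type*} [Fintype E] [DecidableEq E] (c : ℂ)
    (Ψ : E → MvPolynomial σ ℂ) (d : E → ℕ) (hΨ : ∀ e, (Ψ e).IsHomogeneous (d e)) (hd2 : ∀ e, 2 ≤ d e)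
    (hd : Function.Injective d) (z : σ → ℂ) {g : ℕ} (t : Fin g → ℂ) (ht : Function.Injective t)
    (hg : ∀ e, d e - 2 < g) (ρ : ℕ)
    (hnodes : ∀ i, (hess0 (transl (t i • z) (MvPolynomial.C c + ∑ e, Ψ e))).rank ≤ ρ) (a : E → ℂ) :
    (∑ e, a e • hess0 (transl z (Ψ e))).rank ≤ Fintype.card E * ρ := by
  have hk : Function.Injective (fun e => d e - 2) := by
    intro e e' h
    have h2 := hd2 e
    have h2' := hd2 e'
    exact hd (by simp only at h; omega)
  obtain ⟨f, -, W, hW⟩ := exists_rayNodes_leftInverse t ht (fun e => d e - 2) hk hg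
  exact rank_sum_smul_hess0_le_of_rayNodes c Ψ d hΨ z (t ∘ f) ρ (fun i => hnodes (f i)) W hW a

end Ray

end Summit.ValiantsHypothesis.ValiantsHypothesis.Theorems.GrenetZeonTwoDimCoefficients.ScalingClosure

end
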